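import Summits.RiemannHypothesis.RiemannHypothesis.Theorems.SemilocalNegCertUptoHundredThirtyNineKinkedBb
import Summits.RiemannHypothesis.RiemannHypothesis.Theorems.SemilocalNegCertUptoHundredThirtyNineKinkedBc
import Summits.RiemannHypothesis.RiemannHypothesis.Theorems.SemilocalNegCertUptoHundredThirtyNineKinkedBd
import Summits.RiemannHypothesis.RiemannHypothesis.Theorems.SemilocalNegCertUptoHundredThirtyNineKinkedBe
import Summits.RiemannHypothesis.RiemannHypothesis.Theorems.SemilocalNegCertUptoHundredThirtyNineKinkedBf
import Summits.RiemannHypothesis.RiemannHypothesis.Theorems.SemilocalNegCertUptoHundredThirtyNineKinkedBg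
import Summits.RiemannHypothesis.RiemannHypothesis.Theorems.SemilocalNegCertUptoHundredThirtyNineKinkedBh
import Summits.RiemannHypothesis.RiemannHypothesis.Theorems.SemilocalNegCertUptoHundredThirtyNineKinkedBi
import Summits.RiemannHypothesis.RiemannHypothesis.Theorems.SemilocalNegCertUptoHundredThirtyNineKinkedBj
import Summits.RiemannHypothesis.RiemannHypothesis.Theorems.SemilocalNegCertUptoHundredThirtyNineKinkedBk
import Summits.RiemannHypothesis.RiemannHypothesis.Theorems.SemilocalNegCertUptoHundredThirtyNineKinkedBl
import Summits.RiemannHypothesis.RiemannHypothesis.Theorems.SemilocalNegCertUptoHundredThirtyNineKinkedBm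
import Summits.RiemannHypothesis.RiemannHypothesis.Theorems.SemilocalNegCertUptoHundredThirtyNineKinkedBn
import Summits.RiemannHypothesis.RiemannHypothesis.Theorems.SemilocalNegCertUptoHundredThirtyNineKinkedBo
import HarnessLib

/-!
# Semi-local threshold of the `{∞} ∪ {p < 149}` form, negative side: `a*({2,…,139}) ≤ 321/128` — the wall `q = 149` from a KINKED (piecewise-cubic) witness (part 15/18: the composition of the piece facts 450 … 599)

Cell `rh-explicit` (HOME `run/shared/lean/pub/rh-explicit/`), seat cc-s2-4 (A4 SEMILOCAL-TABLE, kernel column; pipeline gen11 `mkkinked.py`).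
Honest framing: theorems about the tree's `weilSemilocalThreshold S`; nothing here bears on RH.  No data is trusted: every bound is a
`decide +kernel` fact of the piecewise certificate `SemilocalPiecewiseCert.lean` (cc-s2-4 gen8).

Instance: `S = {p < 149}`, window `b = 321/128` (last /1024 value below `(log 151)/2`), `N = 150`, 47 atoms; odd piecewise-cubic
witness with 24 slope breaks at the atom images `|b − log n|` nearest `0` (atoms `n = 13, 11, 16, 9, 17, 8, 19, 7, 23, 25, 27, 29, 5, 31, 32, 37, 4, 41, 43, 47, 49, 3, 53, 59`,
rounded to `/1024`); float finder `Re Q/‖G‖² = -1.416e-04` (no polar credit); orders `(10, 4, 8, 4, 10, 40)`, 605 `t`-pieces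
(far widths ≤ 1/4); exact kernel margin `(rhs − lhs)/‖G‖² = 1.4144e-04`.  ⇒ **`a*({p < 149}) ≤ 321/128 < (log 151)/2`**.
The instance is split for the gate into part 1
(table, certificate, `checkMainPW`, the atom side in kernel chunks of ≤ 4 atoms via `SemilocalPiecewiseCertSplit.lean`), parts 2–10
(68 piece facts each in the FLEX layout of `SemilocalPiecewiseCertFlex.lean` (cc-s2-4 gen12, CC4-LEAN §17.2): piece `0` by `checkPiecePW`,
every far piece by `checkPieceFlex i ⟨n, m, K, m', u₀⟩` with the orders that piece needs (mean majorant degree ≈ 62 instead of 176) and a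
short dyadic centre `u₀ ≤ u_K(T₀)` — same witness, same cuts, claims recomputed (`⌈exact⌉ + 1`), kernel margin `1.4142e-04`·‖G‖²; each
fact file imports part 1 only), the Pieces part (composition) and the Final part (theorems).  Folklore throughout.
-/

set_option autoImplicit false
set_option linter.dupNamespace false  -- the mandated namespace repeats `RiemannHypothesis`
set_option Elab.async false  -- serialise the kernel facts: in parallel they exhaust the node's per-process heap (cc-s2-4 gen11, CC4-LEAN §16.10)

noncomputable section

open Complex Filter Set MeasureTheory Topology
open scoped Real

namespace Summit.RiemannHypothesis.RiemannHypothesis.Theorems.SemilocalPolyWitness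

open MeasureTheory Set Finset Real
open Literature.NumberTheory.LFunctions
open Summit.RiemannHypothesis.RiemannHypothesis.Theorems.MotivicDoor
open Summit.RiemannHypothesis.RiemannHypothesis.Theorems.MotivicDoor.SemilocalThreshold
open Summit.RiemannHypothesis.RiemannHypothesis.Theorems.MotivicDoor.SemilocalMarkov
open LQ

/-- pieces `450 ≤ i < 600` of `certUptoHundredThirtyNineKinked` check (FLEX form). -/
theorem check_UptoHundredThirtyNineKinked_pieces_4 : ∀ i, 450 ≤ i → i < 600 →
    certUptoHundredThirtyNineKinked.checkPiecePW i = true ∨ ∃ o, certUptoHundredThirtyNineKinked.checkPieceFlex i o = true := by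
  intro i hlo hhi
  interval_cases i
  · exact Or.inr ⟨_, check_UptoHundredThirtyNineKinked_piece450⟩
  · exact Or.inr ⟨_, check_UptoHundredThirtyNineKinked_piece451⟩
  · exact Or.inr ⟨_, check_UptoHundredThirtyNineKinked_piece452⟩
  · exact Or.inr ⟨_, check_UptoHundredThirtyNineKinked_piece453⟩
  · exact Or.inr ⟨_, check_UptoHundredThirtyNineKinked_piece454⟩
  · exact Or.inr ⟨_, check_UptoHundredThirtyNineKinked_piece455⟩
  · exact Or.inr ⟨_, check_UptoHundredThirtyNineKinked_piece456⟩
  · exact Or.inr ⟨_, check_UptoHundredThirtyNineKinked_piece457⟩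
  · exact Or.inr ⟨_, check_UptoHundredThirtyNineKinked_piece458⟩
  · exact Or.inr ⟨_, check_UptoHundredThirtyNineKinked_piece459⟩
  · exact Or.inr ⟨_, check_UptoHundredThirtyNineKinked_piece460⟩
  · exact Or.inr ⟨_, check_UptoHundredThirtyNineKinked_piece461⟩
  · exact Or.inr ⟨_, check_UptoHundredThirtyNineKinked_piece462⟩
  · exact Or.inr ⟨_, check_UptoHundredThirtyNineKinked_piece463⟩
  · exact Or.inr ⟨_, check_UptoHundredThirtyNineKinked_piece464⟩
  · exact Or.inr ⟨_, check_UptoHundredThirtyNineKinked_piece465⟩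
  · exact Or.inr ⟨_, check_UptoHundredThirtyNineKinked_piece466⟩
  · exact Or.inr ⟨_, check_UptoHundredThirtyNineKinked_piece467⟩
  · exact Or.inr ⟨_, check_UptoHundredThirtyNineKinked_piece468⟩
  · exact Or.inr ⟨_, check_UptoHundredThirtyNineKinked_piece469⟩
  · exact Or.inr ⟨_, check_UptoHundredThirtyNineKinked_piece470⟩
  · exact Or.inr ⟨_, check_UptoHundredThirtyNineKinked_piece471⟩
  · exact Or.inr ⟨_, check_UptoHundredThirtyNineKinked_piece472⟩
  · exact Or.inr ⟨_, check_UptoHundredThirtyNineKinked_piece473⟩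
  · exact Or.inr ⟨_, check_UptoHundredThirtyNineKinked_piece474⟩
  · exact Or.inr ⟨_, check_UptoHundredThirtyNineKinked_piece475⟩
  · exact Or.inr ⟨_, check_UptoHundredThirtyNineKinked_piece476⟩
  · exact Or.inr ⟨_, check_UptoHundredThirtyNineKinked_piece477⟩
  · exact Or.inr ⟨_, check_UptoHundredThirtyNineKinked_piece478⟩
  · exact Or.inr ⟨_, check_UptoHundredThirtyNineKinked_piece479⟩
  · exact Or.inr ⟨_, check_UptoHundredThirtyNineKinked_piece480⟩
  · exact Or.inr ⟨_, check_UptoHundredThirtyNineKinked_piece481⟩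
  · exact Or.inr ⟨_, check_UptoHundredThirtyNineKinked_piece482⟩
  · exact Or.inr ⟨_, check_UptoHundredThirtyNineKinked_piece483⟩
  · exact Or.inr ⟨_, check_UptoHundredThirtyNineKinked_piece484⟩
  · exact Or.inr ⟨_, check_UptoHundredThirtyNineKinked_piece485⟩
  · exact Or.inr ⟨_, check_UptoHundredThirtyNineKinked_piece486⟩
  · exact Or.inr ⟨_, check_UptoHundredThirtyNineKinked_piece487⟩
  · exact Or.inr ⟨_, check_UptoHundredThirtyNineKinked_piece488⟩
  · exact Or.inr ⟨_, check_UptoHundredThirtyNineKinked_piece489⟩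
  · exact Or.inr ⟨_, check_UptoHundredThirtyNineKinked_piece490⟩
  · exact Or.inr ⟨_, check_UptoHundredThirtyNineKinked_piece491⟩
  · exact Or.inr ⟨_, check_UptoHundredThirtyNineKinked_piece492⟩
  · exact Or.inr ⟨_, check_UptoHundredThirtyNineKinked_piece493⟩
  · exact Or.inr ⟨_, check_UptoHundredThirtyNineKinked_piece494⟩
  · exact Or.inr ⟨_, check_UptoHundredThirtyNineKinked_piece495⟩
  · exact Or.inr ⟨_, check_UptoHundredThirtyNineKinked_piece496⟩
  · exact Or.inr ⟨_, check_UptoHundredThirtyNineKinked_piece497⟩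
  · exact Or.inr ⟨_, check_UptoHundredThirtyNineKinked_piece498⟩
  · exact Or.inr ⟨_, check_UptoHundredThirtyNineKinked_piece499⟩
  · exact Or.inr ⟨_, check_UptoHundredThirtyNineKinked_piece500⟩
  · exact Or.inr ⟨_, check_UptoHundredThirtyNineKinked_piece501⟩
  · exact Or.inr ⟨_, check_UptoHundredThirtyNineKinked_piece502⟩
  · exact Or.inr ⟨_, check_UptoHundredThirtyNineKinked_piece503⟩
  · exact Or.inr ⟨_, check_UptoHundredThirtyNineKinked_piece504⟩
  · exact Or.inr ⟨_, check_UptoHundredThirtyNineKinked_piece505⟩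
  · exact Or.inr ⟨_, check_UptoHundredThirtyNineKinked_piece506⟩
  · exact Or.inr ⟨_, check_UptoHundredThirtyNineKinked_piece507⟩
  · exact Or.inr ⟨_, check_UptoHundredThirtyNineKinked_piece508⟩
  · exact Or.inr ⟨_, check_UptoHundredThirtyNineKinked_piece509⟩
  · exact Or.inr ⟨_, check_UptoHundredThirtyNineKinked_piece510⟩
  · exact Or.inr ⟨_, check_UptoHundredThirtyNineKinked_piece511⟩
  · exact Or.inr ⟨_, check_UptoHundredThirtyNineKinked_piece512⟩
  · exact Or.inr ⟨_, check_UptoHundredThirtyNineKinked_piece513⟩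
  · exact Or.inr ⟨_, check_UptoHundredThirtyNineKinked_piece514⟩
  · exact Or.inr ⟨_, check_UptoHundredThirtyNineKinked_piece515⟩
  · exact Or.inr ⟨_, check_UptoHundredThirtyNineKinked_piece516⟩
  · exact Or.inr ⟨_, check_UptoHundredThirtyNineKinked_piece517⟩
  · exact Or.inr ⟨_, check_UptoHundredThirtyNineKinked_piece518⟩
  · exact Or.inr ⟨_, check_UptoHundredThirtyNineKinked_piece519⟩
  · exact Or.inr ⟨_, check_UptoHundredThirtyNineKinked_piece520⟩
  · exact Or.inr ⟨_, check_UptoHundredThirtyNineKinked_piece521⟩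
  · exact Or.inr ⟨_, check_UptoHundredThirtyNineKinked_piece522⟩
  · exact Or.inr ⟨_, check_UptoHundredThirtyNineKinked_piece523⟩
  · exact Or.inr ⟨_, check_UptoHundredThirtyNineKinked_piece524⟩
  · exact Or.inr ⟨_, check_UptoHundredThirtyNineKinked_piece525⟩
  · exact Or.inr ⟨_, check_UptoHundredThirtyNineKinked_piece526⟩
  · exact Or.inr ⟨_, check_UptoHundredThirtyNineKinked_piece527⟩
  · exact Or.inr ⟨_, check_UptoHundredThirtyNineKinked_piece528⟩
  · exact Or.inr ⟨_, check_UptoHundredThirtyNineKinked_piece529⟩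
  · exact Or.inr ⟨_, check_UptoHundredThirtyNineKinked_piece530⟩
  · exact Or.inr ⟨_, check_UptoHundredThirtyNineKinked_piece531⟩
  · exact Or.inr ⟨_, check_UptoHundredThirtyNineKinked_piece532⟩
  · exact Or.inr ⟨_, check_UptoHundredThirtyNineKinked_piece533⟩
  · exact Or.inr ⟨_, check_UptoHundredThirtyNineKinked_piece534⟩
  · exact Or.inr ⟨_, check_UptoHundredThirtyNineKinked_piece535⟩
  · exact Or.inr ⟨_, check_UptoHundredThirtyNineKinked_piece536⟩
  · exact Or.inr ⟨_, check_UptoHundredThirtyNineKinked_piece537⟩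
  · exact Or.inr ⟨_, check_UptoHundredThirtyNineKinked_piece538⟩
  · exact Or.inr ⟨_, check_UptoHundredThirtyNineKinked_piece539⟩
  · exact Or.inr ⟨_, check_UptoHundredThirtyNineKinked_piece540⟩
  · exact Or.inr ⟨_, check_UptoHundredThirtyNineKinked_piece541⟩
  · exact Or.inr ⟨_, check_UptoHundredThirtyNineKinked_piece542⟩
  · exact Or.inr ⟨_, check_UptoHundredThirtyNineKinked_piece543⟩
  · exact Or.inr ⟨_, check_UptoHundredThirtyNineKinked_piece544⟩
  · exact Or.inr ⟨_, check_UptoHundredThirtyNineKinked_piece545⟩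
  · exact Or.inr ⟨_, check_UptoHundredThirtyNineKinked_piece546⟩
  · exact Or.inr ⟨_, check_UptoHundredThirtyNineKinked_piece547⟩
  · exact Or.inr ⟨_, check_UptoHundredThirtyNineKinked_piece548⟩
  · exact Or.inr ⟨_, check_UptoHundredThirtyNineKinked_piece549⟩
  · exact Or.inr ⟨_, check_UptoHundredThirtyNineKinked_piece550⟩
  · exact Or.inr ⟨_, check_UptoHundredThirtyNineKinked_piece551⟩
  · exact Or.inr ⟨_, check_UptoHundredThirtyNineKinked_piece552⟩
  · exact Or.inr ⟨_, check_UptoHundredThirtyNineKinked_piece553⟩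
  · exact Or.inr ⟨_, check_UptoHundredThirtyNineKinked_piece554⟩
  · exact Or.inr ⟨_, check_UptoHundredThirtyNineKinked_piece555⟩
  · exact Or.inr ⟨_, check_UptoHundredThirtyNineKinked_piece556⟩
  · exact Or.inr ⟨_, check_UptoHundredThirtyNineKinked_piece557⟩
  · exact Or.inr ⟨_, check_UptoHundredThirtyNineKinked_piece558⟩
  · exact Or.inr ⟨_, check_UptoHundredThirtyNineKinked_piece559⟩
  · exact Or.inr ⟨_, check_UptoHundredThirtyNineKinked_piece560⟩
  · exact Or.inr ⟨_, check_UptoHundredThirtyNineKinked_piece561⟩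
  · exact Or.inr ⟨_, check_UptoHundredThirtyNineKinked_piece562⟩
  · exact Or.inr ⟨_, check_UptoHundredThirtyNineKinked_piece563⟩
  · exact Or.inr ⟨_, check_UptoHundredThirtyNineKinked_piece564⟩
  · exact Or.inr ⟨_, check_UptoHundredThirtyNineKinked_piece565⟩
  · exact Or.inr ⟨_, check_UptoHundredThirtyNineKinked_piece566⟩
  · exact Or.inr ⟨_, check_UptoHundredThirtyNineKinked_piece567⟩
  · exact Or.inr ⟨_, check_UptoHundredThirtyNineKinked_piece568⟩
  · exact Or.inr ⟨_, check_UptoHundredThirtyNineKinked_piece569⟩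
  · exact Or.inr ⟨_, check_UptoHundredThirtyNineKinked_piece570⟩
  · exact Or.inr ⟨_, check_UptoHundredThirtyNineKinked_piece571⟩
  · exact Or.inr ⟨_, check_UptoHundredThirtyNineKinked_piece572⟩
  · exact Or.inr ⟨_, check_UptoHundredThirtyNineKinked_piece573⟩
  · exact Or.inr ⟨_, check_UptoHundredThirtyNineKinked_piece574⟩
  · exact Or.inr ⟨_, check_UptoHundredThirtyNineKinked_piece575⟩
  · exact Or.inr ⟨_, check_UptoHundredThirtyNineKinked_piece576⟩
  · exact Or.inr ⟨_, check_UptoHundredThirtyNineKinked_piece577⟩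
  · exact Or.inr ⟨_, check_UptoHundredThirtyNineKinked_piece578⟩
  · exact Or.inr ⟨_, check_UptoHundredThirtyNineKinked_piece579⟩
  · exact Or.inr ⟨_, check_UptoHundredThirtyNineKinked_piece580⟩
  · exact Or.inr ⟨_, check_UptoHundredThirtyNineKinked_piece581⟩
  · exact Or.inr ⟨_, check_UptoHundredThirtyNineKinked_piece582⟩
  · exact Or.inr ⟨_, check_UptoHundredThirtyNineKinked_piece583⟩
  · exact Or.inr ⟨_, check_UptoHundredThirtyNineKinked_piece584⟩
  · exact Or.inr ⟨_, check_UptoHundredThirtyNineKinked_piece585⟩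
  · exact Or.inr ⟨_, check_UptoHundredThirtyNineKinked_piece586⟩
  · exact Or.inr ⟨_, check_UptoHundredThirtyNineKinked_piece587⟩
  · exact Or.inr ⟨_, check_UptoHundredThirtyNineKinked_piece588⟩
  · exact Or.inr ⟨_, check_UptoHundredThirtyNineKinked_piece589⟩
  · exact Or.inr ⟨_, check_UptoHundredThirtyNineKinked_piece590⟩
  · exact Or.inr ⟨_, check_UptoHundredThirtyNineKinked_piece591⟩
  · exact Or.inr ⟨_, check_UptoHundredThirtyNineKinked_piece592⟩
  · exact Or.inr ⟨_, check_UptoHundredThirtyNineKinked_piece593⟩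
  · exact Or.inr ⟨_, check_UptoHundredThirtyNineKinked_piece594⟩
  · exact Or.inr ⟨_, check_UptoHundredThirtyNineKinked_piece595⟩
  · exact Or.inr ⟨_, check_UptoHundredThirtyNineKinked_piece596⟩
  · exact Or.inr ⟨_, check_UptoHundredThirtyNineKinked_piece597⟩
  · exact Or.inr ⟨_, check_UptoHundredThirtyNineKinked_piece598⟩
  · exact Or.inr ⟨_, check_UptoHundredThirtyNineKinked_piece599⟩

end Summit.RiemannHypothesis.RiemannHypothesis.Theorems.SemilocalPolyWitness

end
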